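import Summits.HubbardSuperconductivity.HubbardSuperconductivity.Theorems.AnisotropyChordTransferFibre3FamilyALemmas

/-!
# Route `AnisotropyChord` / H0 rotor rung: PartN38 — `PsiZeroPrimitive`: TRUE on `(0, π)`, FALSE AS TYPED on `(π, 2π)`

Typed target `PsiZeroPrimitive` of `…Fibre3FamilyALemmas` (PORT PartN38, theory seat `hubbard-h0-rotor-theory-1` g21, memo 21
§316) claims, for every `k ∈ (0, 2π)`,
`d/dk [−¼ log((1 + √(1 − s⁴))/s²)] = 1/(4 s √(1+s²))`, `s = sin(k/2)`.
Since `√(1 − s⁴) = |cos(k/2)|·√(1+s²)`, the derivative is `sign(cos(k/2))/(4 s √(1+s²))`: the claim is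
**true on `(0, π)`** (`psiZeroPrimitive_of_lt_pi`) and **false on `(π, 2π)`** — at `k = 4π/3` the derivative is
`−1/(4 s √(1+s²)) ≠ +1/(4 s √(1+s²))`, so **`not_psiZeroPrimitive : ¬ PsiZeroPrimitive`** (uniqueness of derivatives).
REPAIR for the theory seat: restrict to `0 < k < π` (the row profile `ψ₀` is symmetric under `k ↦ 2π − k`), or use the
primitive `−¼·sign(cos(k/2))·log(…)`.  
Prover seat `hubbard-h0-rotor-p1` g23; helper for stmt-HubbardSuperconductivity-19089 (`--supports`).
-/

set_option linter.dupNamespace false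
set_option autoImplicit false

noncomputable section

namespace Summit.HubbardSuperconductivity.HubbardSuperconductivity.Theorems.AnisotropyChord.Transfer.Fibre3

/-- `√(1 − s⁴) = |cos(k/2)|·√(1 + s²)` for `s = sin(k/2)`. [folklore] -/
theorem sqrt_one_sub_sin_four (k : ℝ) :
    Real.sqrt (1 - Real.sin (k / 2) ^ 4) = |Real.cos (k / 2)| * Real.sqrt (1 + Real.sin (k / 2) ^ 2) := by
  have hab : Real.sin (k / 2) ^ 2 + Real.cos (k / 2) ^ 2 = 1 := Real.sin_sq_add_cos_sq (k / 2)
  have e : 1 - Real.sin (k / 2) ^ 4 = Real.cos (k / 2) ^ 2 * (1 + Real.sin (k / 2) ^ 2) := by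
    have : Real.cos (k / 2) ^ 2 = 1 - Real.sin (k / 2) ^ 2 := by linarith
    rw [this]; ring
  rw [e, Real.sqrt_mul (sq_nonneg _), Real.sqrt_sq_eq_abs]

/-- ★ **`PsiZeroPrimitive` restricted to `(0, π)` holds.** [folklore] -/
theorem psiZeroPrimitive_of_lt_pi (k : ℝ) (hk0 : 0 < k) (hkπ : k < Real.pi) :
    HasDerivAt (fun k => -(1 / 4 : ℝ) * Real.log ((1 + Real.sqrt (1 - Real.sin (k / 2) ^ 4)) / Real.sin (k / 2) ^ 2))
      (1 / (4 * Real.sin (k / 2) * Real.sqrt (1 + Real.sin (k / 2) ^ 2))) k := by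
  set s : ℝ := Real.sin (k / 2) with hsdef
  set c : ℝ := Real.cos (k / 2) with hcdef
  have hs0 : 0 < s := Real.sin_pos_of_pos_of_lt_pi (by linarith) (by linarith)
  have hc0 : 0 < c := Real.cos_pos_of_mem_Ioo ⟨by linarith, by linarith⟩
  have hab : s ^ 2 + c ^ 2 = 1 := Real.sin_sq_add_cos_sq (k / 2)
  set W : ℝ := Real.sqrt (1 + s ^ 2) with hWdef
  have hW0 : 0 < W := Real.sqrt_pos.mpr (by positivity)
  have hWW : W ^ 2 = 1 + s ^ 2 := Real.sq_sqrt (by positivity)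
  have hR : Real.sqrt (1 - s ^ 4) = c * W := by
    have := sqrt_one_sub_sin_four k
    rw [abs_of_pos hc0] at this
    exact this
  have hu : 1 - s ^ 4 ≠ 0 := by
    intro h
    have : Real.sqrt (1 - s ^ 4) = 0 := by rw [h, Real.sqrt_zero]
    rw [hR] at this
    exact absurd this (by positivity)
  -- chain rule
  have hs' : HasDerivAt (fun k : ℝ => Real.sin (k / 2)) (Real.cos (k / 2) * (1 / 2)) k :=
    ((hasDerivAt_id' k).div_const 2).sin
  have hs4 := hs'.pow 4
  have hu' := (hasDerivAt_const k (1 : ℝ)).sub hs4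
  have hRd := hu'.sqrt hu
  have hN := (hasDerivAt_const k (1 : ℝ)).add hRd
  have hD := hs'.pow 2
  have hQ := hN.div hD (pow_ne_zero 2 hs0.ne')
  have hpos : 0 < (1 + Real.sqrt (1 - Real.sin (k / 2) ^ 4)) / Real.sin (k / 2) ^ 2 := by
    apply div_pos
    · have := Real.sqrt_nonneg (1 - Real.sin (k / 2) ^ 4); linarith
    · positivity
  have hL := hQ.log hpos.ne'
  have hraw := hL.const_mul (-(1 / 4 : ℝ))
  refine hraw.congr_deriv ?_
  simp only [Pi.add_apply, Pi.sub_apply, Pi.pow_apply, Pi.div_apply]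
  simp only [← hsdef, ← hcdef]
  rw [hR]
  simp only [show (4 : ℕ) - 1 = 3 from rfl, show (2 : ℕ) - 1 = 1 from rfl, pow_one, zero_add, zero_sub]
  have h1 : 1 + c * W ≠ 0 := by positivity
  field_simp
  push_cast
  linear_combination (4 * c ^ 2) * hWW + (4 * (1 + s ^ 2)) * hab

/-- on `(π, 2π)` the derivative has the OPPOSITE sign: at `k ∈ (π, 2π)` with `cos(k/2) < 0`,
`F'(k) = −1/(4 s √(1+s²))`. [folklore] -/
theorem psiZero_hasDerivAt_neg (k : ℝ) (hkπ : Real.pi < k) (hk2 : k < 2 * Real.pi) :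
    HasDerivAt (fun k => -(1 / 4 : ℝ) * Real.log ((1 + Real.sqrt (1 - Real.sin (k / 2) ^ 4)) / Real.sin (k / 2) ^ 2))
      (-(1 / (4 * Real.sin (k / 2) * Real.sqrt (1 + Real.sin (k / 2) ^ 2)))) k := by
  set s : ℝ := Real.sin (k / 2) with hsdef
  set c : ℝ := Real.cos (k / 2) with hcdef
  have hs0 : 0 < s := Real.sin_pos_of_pos_of_lt_pi (by linarith [Real.pi_pos]) (by linarith)
  have hc0 : c < 0 := Real.cos_neg_of_pi_div_two_lt_of_lt (by linarith) (by linarith)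
  have hab : s ^ 2 + c ^ 2 = 1 := Real.sin_sq_add_cos_sq (k / 2)
  set W : ℝ := Real.sqrt (1 + s ^ 2) with hWdef
  have hW0 : 0 < W := Real.sqrt_pos.mpr (by positivity)
  have hWW : W ^ 2 = 1 + s ^ 2 := Real.sq_sqrt (by positivity)
  have hR : Real.sqrt (1 - s ^ 4) = -c * W := by
    have := sqrt_one_sub_sin_four k
    rw [abs_of_neg hc0] at this
    exact this
  have hu : 1 - s ^ 4 ≠ 0 := by
    intro h
    have : Real.sqrt (1 - s ^ 4) = 0 := by rw [h, Real.sqrt_zero]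
    rw [hR] at this
    have : 0 < -c * W := by have := neg_pos.mpr hc0; positivity
    linarith
  -- chain rule
  have hs' : HasDerivAt (fun k : ℝ => Real.sin (k / 2)) (Real.cos (k / 2) * (1 / 2)) k :=
    ((hasDerivAt_id' k).div_const 2).sin
  have hs4 := hs'.pow 4
  have hu' := (hasDerivAt_const k (1 : ℝ)).sub hs4
  have hRd := hu'.sqrt hu
  have hN := (hasDerivAt_const k (1 : ℝ)).add hRd
  have hD := hs'.pow 2
  have hQ := hN.div hD (pow_ne_zero 2 hs0.ne')
  have hpos : 0 < (1 + Real.sqrt (1 - Real.sin (k / 2) ^ 4)) / Real.sin (k / 2) ^ 2 := by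
    apply div_pos
    · have := Real.sqrt_nonneg (1 - Real.sin (k / 2) ^ 4); linarith
    · positivity
  have hL := hQ.log hpos.ne'
  have hraw := hL.const_mul (-(1 / 4 : ℝ))
  refine hraw.congr_deriv ?_
  simp only [Pi.add_apply, Pi.sub_apply, Pi.pow_apply, Pi.div_apply]
  simp only [← hsdef, ← hcdef]
  rw [hR]
  simp only [show (4 : ℕ) - 1 = 3 from rfl, show (2 : ℕ) - 1 = 1 from rfl, pow_one, zero_add, zero_sub]
  have h1 : 1 + -(c * W) ≠ 0 := by nlinarith [mul_pos (neg_pos.mpr hc0) hW0]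
  have hc1 : c ≠ 0 := hc0.ne
  field_simp
  push_cast
  linear_combination (-4 * c ^ 2) * hWW + (-4 * (1 + s ^ 2)) * hab

/-- ★ **`PsiZeroPrimitive` AS TYPED (on all of `(0, 2π)`) is false:** at `k = 4π/3` the claimed derivative has the wrong sign. [folklore] -/
theorem not_psiZeroPrimitive : ¬ PsiZeroPrimitive := by
  intro h
  set k : ℝ := 4 * Real.pi / 3 with hk
  have hπ := Real.pi_pos
  have h1 : Real.pi < k := by rw [hk]; linarith
  have h2 : k < 2 * Real.pi := by rw [hk]; linarith
  have hA := h k (by linarith) h2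
  have hB := psiZero_hasDerivAt_neg k h1 h2
  have heq := hA.unique hB
  have hs0 : 0 < Real.sin (k / 2) := Real.sin_pos_of_pos_of_lt_pi (by linarith) (by linarith)
  have hW0 : 0 < Real.sqrt (1 + Real.sin (k / 2) ^ 2) := Real.sqrt_pos.mpr (by positivity)
  have hpos : 0 < 1 / (4 * Real.sin (k / 2) * Real.sqrt (1 + Real.sin (k / 2) ^ 2)) := by positivity
  linarith

end Summit.HubbardSuperconductivity.HubbardSuperconductivity.Theorems.AnisotropyChord.Transfer.Fibre3

end
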